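import Literature.AlgebraicGeometry.Resolution.ProperModels
import Literature.AlgebraicGeometry.Resolution.QuasiExcellentSchemes
import Mathlib.RingTheory.EssentialFiniteness
import HarnessLib

/-!
# Two-model patching of proper models: Piltant's form, the one-morphism form, and the
# sandwiched-resolution statement it reduces to

Topic: `Literature/AlgebraicGeometry/Resolution`. Zariski's patching of two models (Zariski 1944,
Fundamental Theorem p. 539; Piltant 2013, Prop. 5.1 with `P = P_reg`: "Let `X₁/k` and `X₂/k` be
two projective models of `K`. There exists a normal and projective model `Y/k` of `K`, together
with morphisms `πᵢ : Y → Xᵢ`, such that `πᵢ⁻¹(Reg_P(Xᵢ)) ⊆ Reg_P(Y)`") is the statement that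
`resolutionInChar_of_twoModelPatching_of_relLU` (`ZariskiPatchingAllDimensions.lean`) isolates
as the open core of the implication "local uniformization ⇒ resolution" in dimension `≥ 4`
("All of these problems are open in dimension four or more", Piltant 2013, p. 2). This file
records the statement for PROPER models (`ProperModels.lean`; Piltant's own output in the proof
of Prop. 5.1, Step 5, is a proper model obtained by gluing) in three equivalent-or-stronger
forms, as DEFINITIONS (nothing is asserted; the formal implications between them are proved in
the companion file `ProperModelsPatchingJoin.lean`):

* `ProperModel.TwoModelPatching p` — Piltant's form for proper models over fields of
  characteristic `p`.
* `ProperModel.RegLeification p` — the ONE-MORPHISM form: every `φ : M → Y` is refined by some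
  `ψ : M' → M` with `ψ⁻¹(Reg M) ⊆ Reg M'` and `(φψ)⁻¹(Reg Y) ⊆ Reg M'`.
* (companion file `ProperModelsPatchingJoin.lean`: `twoModelPatching_of_regLeification` — RegLe-ification
  twice on the join gives two-model patching — and its converse; the two forms are EQUIVALENT.)
* `ProperModel.LocalRegLeification p` — the one-morphism form before compactification: an open
  `O ⊆ M` containing `Reg M ∪ φ⁻¹(Reg Y)` and a proper birational integral `N → O` regular over
  both loci (what gluing a strong resolution of `φ⁻¹(Reg Y)` to `M ∖ cl Sing φ⁻¹(Reg Y)`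
  produces; it becomes `RegLeification` after a Nagata compactification of `N → M`).
* `SandwichedStrongResolution p` — strong (iso over `Reg`) resolution of integral schemes proper
  and birational over a REGULAR integral separated `k`-scheme of finite type, `char k = p`: the
  conclusion shape of `CossartPiltant2019General` (Cossart–Piltant 2019, Thm. 1.1 (i)–(ii), the
  case of dimension `≤ 3`); OPEN in dimension `≥ 4`. A CONJECTURE-type definition, not a fact.

## References

* O. Zariski, Ann. of Math. 45 (1944), Fundamental Theorem p. 539 (via Piltant).
* O. Piltant, *An axiomatic version of Zariski's patching theorem*, RACSAM 107 (2013) 91–121,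
  p. 2, Prop. 5.1 and its proof, Step 5. [Piltant2013]
* V. Cossart, O. Piltant, J. Algebra 529 (2019), Thm. 1.1. [CossartPiltant2019]
-/

noncomputable section

open CategoryTheory AlgebraicGeometry

namespace Literature.AlgebraicGeometry.Resolution

universe u

namespace ProperModel

/-- **Two-model patching of proper models in characteristic `p`** (Piltant 2013, Prop. 5.1 with
`P = P_reg`, for proper instead of projective models and without normality of `Y`): for every
field `k` of characteristic `p`, every `K/k` essentially of finite type and any two proper models
`M₁, M₂` of `K/k` there are a proper model `N` and morphisms of models `φᵢ : N → Mᵢ` with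
`φᵢ⁻¹(Reg Mᵢ) ⊆ Reg N` (`Hom.RegLe`). Known in transcendence degree `≤ 3`, OPEN in `≥ 4`
(Piltant 2013, p. 2); a statement, not a fact.
[cite: Piltant2013, Prop. 5.1 (P = P_reg), shape for proper models; open in trdeg ≥ 4, p. 2] -/
def TwoModelPatching (p : ℕ) : Prop :=
  ∀ (k : Type u) [Field k] [CharP k p] (K : Type u) [Field K] [Algebra k K]
    [Algebra.EssFiniteType k K], ∀ M₁ M₂ : ProperModel k K,
      ∃ (N : ProperModel k K) (φ₁ : N.Hom M₁) (φ₂ : N.Hom M₂), φ₁.RegLe ∧ φ₂.RegLe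

/-- **RegLe-ification of one morphism of proper models in characteristic `p`**: every morphism
`φ : M → Y` of proper models of a `K/k` essentially of finite type, `char k = p`, is refined by a
proper model `ψ : M' → M` with `ψ⁻¹(Reg M) ⊆ Reg M'` and `(ψ ≫ φ)⁻¹(Reg Y) ⊆ Reg M'`.
Equivalent to `TwoModelPatching p` (`ProperModelsPatchingJoin.lean`). [folklore] -/
def RegLeification (p : ℕ) : Prop :=
  ∀ (k : Type u) [Field k] [CharP k p] (K : Type u) [Field K] [Algebra k K]
    [Algebra.EssFiniteType k K], ∀ (M Y : ProperModel k K) (φ : M.Hom Y),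
      ∃ (M' : ProperModel k K) (ψ : M'.Hom M), ψ.RegLe ∧ (ψ.comp φ).RegLe

/-- **Local RegLe-ification** (the one-morphism form before compactification): for `φ : M → Y`
there are an open `O ⊆ M` containing every regular point of `M` and every point lying over a
regular point of `Y`, an integral scheme `N` and a proper birational `ρ : N → O` such that every
point of `N` over a regular point of `M`, or over a point mapping to a regular point of `Y`, is
regular. (Realised by gluing a strong resolution of `φ⁻¹(Reg Y)` to `M ∖ cl Sing φ⁻¹(Reg Y)`
along `Reg φ⁻¹(Reg Y)`; a Nagata compactification of `N → M` turns it into `RegLeification`.)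
[folklore] -/
def LocalRegLeification (p : ℕ) : Prop :=
  ∀ (k : Type u) [Field k] [CharP k p] (K : Type u) [Field K] [Algebra k K]
    [Algebra.EssFiniteType k K], ∀ (M Y : ProperModel k K) (φ : M.Hom Y),
      ∃ (O : M.X.Opens) (N : Scheme.{u}) (ρ : N ⟶ (O : Scheme.{u})),
        IsIntegral N ∧ IsProper ρ ∧ IsBirational ρ ∧
        (∀ m : M.X, IsRegularLocalRing (M.X.presheaf.stalk m) → m ∈ O) ∧
        (∀ m : M.X, IsRegularLocalRing (Y.X.presheaf.stalk (φ.f m)) → m ∈ O) ∧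
        (∀ n : N, IsRegularLocalRing (M.X.presheaf.stalk (ρ n).1) →
          IsRegularLocalRing (N.presheaf.stalk n)) ∧
        (∀ n : N, IsRegularLocalRing (Y.X.presheaf.stalk (φ.f (ρ n).1)) →
          IsRegularLocalRing (N.presheaf.stalk n))

end ProperModel

/-- **SAND⁺(p) — strong resolution of SANDWICHED schemes in characteristic `p`**: for a field `k`
of characteristic `p`, a REGULAR integral separated `k`-scheme of finite type `U` and an integral
`V` proper and birational over `U` (`η : V → U`), there is a resolution `π : Y → V` (proper,
birational, `Y` regular) which is an isomorphism over an open `W ⊆ V` whose points are exactly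
`Reg V`. This is the conclusion shape of `CossartPiltant2019General` (Cossart–Piltant 2019,
Thm. 1.1 (i)–(ii)), which proves the case `dim V ≤ 3`; the statement for all dimensions is OPEN
(a conjecture-type definition — users take `(h : SandwichedStrongResolution p)`, nobody may assert
it). Every exceptional prime divisor over such a `V` is ruled over its centre on `U` (Abhyankar
1956), so the sandwiched class is a strict subclass of all singularities.
[cite: CossartPiltant2019, Thm. 1.1 (i)-(ii): conclusion shape, proved for dim ≤ 3 only; all dimensions OPEN] -/
def SandwichedStrongResolution (p : ℕ) : Prop :=
  ∀ (k : Type u) [Field k] [CharP k p] (U V : Scheme.{u}) (f : U ⟶ Spec (.of k)) (η : V ⟶ U),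
    IsSeparated f → LocallyOfFiniteType f → QuasiCompact f → IsIntegral U →
    Scheme.IsRegular U → IsIntegral V → IsProper η → IsBirational η →
      ∃ (Y : Scheme.{u}) (π : Y ⟶ V), IsResolution π ∧
        ∃ W : V.Opens, (W : Set V) = Scheme.regularLocus V ∧ IsIso (π ∣_ W)

/-- The degenerate instance `V = U` (`η = 𝟙`): a regular `U` is its own strong resolution.
[folklore] -/
theorem sandwichedStrongResolution_self (U : Scheme.{u})
    (hU : Scheme.IsRegular U) :
    ∃ (Y : Scheme.{u}) (π : Y ⟶ U), IsResolution π ∧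
      ∃ W : U.Opens, (W : Set U) = Scheme.regularLocus U ∧ IsIso (π ∣_ W) := by
  refine ⟨U, 𝟙 U, ⟨inferInstance, ⟨⊤, by simp, by simp, inferInstance⟩, hU⟩, ⊤, ?_, inferInstance⟩
  rw [hU.regularLocus_eq_univ]
  rfl

end Literature.AlgebraicGeometry.Resolution

end
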